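import Summits.CriticalPhenomena.SAWScalingLimit.Theorems.SAWDevelopingMapHexConjectureWindowFloorData
import Summits.CriticalPhenomena.SAWScalingLimit.Theorems.SAWDevelopingMapHexConjectureRestrictionCocycleOfRatioModulus
import HarnessLib

/-!
# Crux `HexConjecture` (stmt-CriticalPhenomena-0808), line `root-locality-replaces-loewner`:
target transport along an ARBITRARY admissible floor family (for the re-plumbed bootstrap)

Landing target:
`Summits/CriticalPhenomena/SAWScalingLimit/Theorems/SAWDevelopingMapHexConjectureRestrictionCocycleWindowTransport.lean`
(`--supports stmt-CriticalPhenomena-0808`; lead continuation prover-line-stmt-CriticalPhenomena-0808-c5-0).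

The bootstrap writes the restriction ratio `f = Z'(a,b)/Z(a,b)` as `f = r_e · Q_e` for a floor family
`e δ → a + t`: `r_e = Z'(a,e)/Z(a,e)`, `Q_e = [Z'(a,b)/Z'(a,e)]·[Z(a,e)/Z(a,b)]`.  The MODULUS floor-ratio
limit (crux-10472's target transport in modulus form, the first hypothesis of
`RootLocality.restrictionCocycle_of_floorRatioModulus`, p116941) is quantified over ALL approximating
families of the second floor point; hence `Q_e → exp((5/8)(Re(Ls − Lb) − Re(L's − L'b)))` for EVERY
admissible floor family `e` (`floorFamily_targetTransport`) — not only for the standard approximants of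
`floorData`.  This is the input that lets the lower bound of the squeeze be taken at an ADAPTIVELY chosen
floor point (the window maximiser of `…HexConjectureWindowFloorData.lean`), i.e. that lets the pointwise
short-chord locality be replaced by its window average (`…RestrictionCocycleOfWindowLocality.lean`).
Also here: the generic sequence/gluing/choice lemmas of that argument.
Sources: LawlerSchrammWerner2004SAW (§3.4, Prop. 2), DuminilCopinSmirnov2012 (Lemma 2).
-/

noncomputable section

open scoped BigOperators Topology NNReal ENNReal Classical
open Filter Set MeasureTheory Metric
open Literature.Probability.LatticeModels (HexVertex hexGraph hexCenter Site)
open Literature.Probability.RandomPlanarGeometry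
open Literature.Probability.RandomPlanarGeometry.SAW
open UpperHalfPlane (upperHalfPlaneSet)

namespace Summit.CriticalPhenomena.SAWScalingLimit.Theorems.HexConjecture.RootLocality

open Summit.CriticalPhenomena.SAWScalingLimit.Theorems.ObservableToSLE.FloorRatio

/-! ### Generic lemmas: sequences, gluing, choice -/

/-- From the failure of an eventual property along `𝓝[>] 0` and an eventual property: a positive sequence
tending to `0` along which the first fails and the second holds. [folklore] -/
theorem exists_seq_of_not_eventually {P G : ℝ → Prop} (hP : ¬ ∀ᶠ δ in 𝓝[>] (0 : ℝ), P δ)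
    (hG : ∀ᶠ δ in 𝓝[>] (0 : ℝ), G δ) :
    ∃ u : ℕ → ℝ, Tendsto u atTop (𝓝[>] 0) ∧ ∀ k, ¬ P (u k) ∧ G (u k) ∧ 0 < u k := by
  have h : ∃ᶠ δ in 𝓝[>] (0 : ℝ), ¬ P δ ∧ (G δ ∧ 0 < δ) :=
    (Filter.not_eventually.1 hP).and_eventually (hG.and self_mem_nhdsWithin)
  obtain ⟨u, hu, hu'⟩ := Filter.exists_seq_forall_of_frequently h
  exact ⟨u, hu, fun k => ⟨(hu' k).1, (hu' k).2.1, (hu' k).2.2⟩⟩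

/-- **Gluing along a sequence.**  If `g (u k) → z` along a positive sequence `u` and `h → z` along `𝓝[>] 0`,
the family that equals `g` on the range of `u` and `h` elsewhere tends to `z` along `𝓝[>] 0`. [folklore] -/
theorem tendsto_piecewise_range {u : ℕ → ℝ} (hu0 : ∀ k, 0 < u k) {g h : ℝ → ℂ} {z : ℂ}
    (hg : Tendsto (fun k => g (u k)) atTop (𝓝 z)) (hh : Tendsto h (𝓝[>] 0) (𝓝 z)) :
    Tendsto (fun δ => if δ ∈ Set.range u then g δ else h δ) (𝓝[>] 0) (𝓝 z) := by
  rw [Metric.tendsto_nhds]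
  intro ε hε
  obtain ⟨k₀, hk₀⟩ := Metric.tendsto_atTop.1 hg ε hε
  have hh' := Metric.tendsto_nhds.1 hh ε hε
  have hsmall : ∀ᶠ δ in 𝓝[>] (0 : ℝ), ∀ k ∈ Finset.range k₀, δ < u k :=
    (Finset.range k₀).eventually_all.2 fun k _ => mem_nhdsWithin_of_mem_nhds (Iio_mem_nhds (hu0 k))
  filter_upwards [hh', hsmall] with δ h1 h2
  split_ifs with hmem
  · obtain ⟨k, rfl⟩ := hmem
    refine hk₀ k (not_lt.1 fun hk => ?_)
    exact lt_irrefl _ (h2 k (Finset.mem_range.2 hk))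
  · exact h1

/-- Choice functions from an eventual existence statement. [folklore] -/
theorem exists_fun_of_eventually {α β : Type*} [Nonempty α] [Nonempty β] {l : Filter ℝ}
    {P : ℝ → α → β → Prop} (h : ∀ᶠ δ in l, ∃ x y, P δ x y) :
    ∃ (f : ℝ → α) (g : ℝ → β), ∀ᶠ δ in l, P δ (f δ) (g δ) := by
  classical
  refine ⟨fun δ => if hδ : ∃ x y, P δ x y then hδ.choose else Classical.arbitrary α,
    fun δ => if hδ : ∃ x y, P δ x y then hδ.choose_spec.choose else Classical.arbitrary β, ?_⟩
  filter_upwards [h] with δ hδ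
  simp only [dif_pos hδ]
  exact hδ.choose_spec.choose_spec

/-- A limit along `𝓝[>] 0` in `ε`-form on an initial interval. [folklore] -/
theorem exists_forall_abs_sub_lt {R : ℝ → ℝ} {c : ℝ} (hR : Tendsto R (𝓝[>] 0) (𝓝 c)) {η : ℝ}
    (hη : 0 < η) : ∃ τ₀ : ℝ, 0 < τ₀ ∧ ∀ t : ℝ, 0 < t → t < τ₀ → |R t - c| < η := by
  have h := Metric.tendsto_nhds.1 hR η hη
  rw [eventually_nhdsWithin_iff, Metric.eventually_nhds_iff] at h
  obtain ⟨ε, hε, hball⟩ := h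
  refine ⟨ε, hε, fun t ht0 htε => ?_⟩
  have := hball (y := t) (by rwa [Real.dist_eq, sub_zero, abs_of_pos ht0]) ht0
  rwa [Real.dist_eq] at this


/-- **Registered sub-goal `stub_limitEps`** (crux item stmt-CriticalPhenomena-0808, line
`root-locality-replaces-loewner`, lead continuation c5): the `ε`-form of a one-sided limit
(`exists_forall_abs_sub_lt`). [folklore] -/
theorem stub_limitEps : ∀ (R : ℝ → ℝ) (c : ℝ), Filter.Tendsto R (nhdsWithin 0 (Set.Ioi 0)) (nhds c) → ∀ η : ℝ, 0 < η → ∃ τ₀ : ℝ, 0 < τ₀ ∧ ∀ t : ℝ, 0 < t → t < τ₀ → |R t - c| < η :=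
  fun _ _ hR _ hη => exists_forall_abs_sub_lt hR hη

/-- Two vertical floor mid-edges coincide only if their cells do. [folklore] -/
theorem floorEdge_inj {x y : Site 2}
    (h : s((x - Pi.single 1 1, (1 : Fin 2)), (x, 0)) = s((y - Pi.single 1 1, (1 : Fin 2)), (y, 0))) :
    x = y := by
  have hmem : (y, (0 : Fin 2)) ∈ s((x - Pi.single 1 1, (1 : Fin 2)), (x, 0)) := by
    rw [h]; exact Sym2.mem_mk_right _ _
  rcases Sym2.mem_iff.1 hmem with h' | h'
  · exact absurd (show (0 : Fin 2) = 1 from congrArg Prod.snd h') (by decide)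
  · exact (congrArg Prod.fst h').symm

/-- The bootstrap factorisation `f = r · Q`. [folklore] -/
theorem ratio_eq_mul {Zb Z'b Ze Z'e : ℝ} (hZe : Ze ≠ 0) (hZ'e : Z'e ≠ 0) :
    Z'b / Zb = (Z'e / Ze) * ((Z'b / Z'e) * (Ze / Zb)) := by
  field_simp

/-- A positive real shift of a point is a different point. [folklore] -/
theorem pt_add_ne {p : ℂ} {t : ℝ} (ht : 0 < t) : p + (t : ℂ) ≠ p := by
  intro h
  have h' : ((t : ℝ) : ℂ) = 0 := by
    have := congrArg (fun z => z - p) h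
    simpa using this
  exact ht.ne' (by exact_mod_cast h')

/-! ### Target transport along an arbitrary admissible floor family -/

/-- **TARGET TRANSPORT ALONG AN ARBITRARY ADMISSIBLE FLOOR FAMILY.**  Setting: the floor-class data of the
mechanism stub (nested admissible families `Λ' δ ⊆ Λ δ`, exact rows in the rigid balls, `δ·mid(a δ) → a`,
`δ·mid(b δ) → b`), the two conformal packages `(Ψ, L, Lb)` of `D` and `(Ψ', L', L'b)` of `D'` with their
flatness radius `ρ₁ ≤ ρ`, a floor point `s = a + t` (`0 < t ≤ ρ₁/4`) on the frontier of both domains with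
boundary values `Ls`, `L's` of the logarithms, and the MODULUS floor-ratio limit `hFRM` (quantified over all
approximating families).  Then for EVERY floor family `e δ → s` that is eventually a boundary mid-edge of
both families in the row of the root with nonempty walk spaces, the bootstrap quotient
`Q_e = [Z'(a,b)/Z'(a,e)]·[Z(a,e)/Z(a,b)]` tends to `exp((5/8)(Re(Ls − Lb) − Re(L's − L'b)))`.
[cite: LawlerSchrammWerner2004SAW, §3.4 ("SAW satisfies restriction") and Prop. 2] -/
theorem floorFamily_targetTransport
    (hFRM : (∀ (D D' : DobrushinDomain) (ρ : ℝ) (Λ : ℝ → Finset HexVertex) (m₀ m m' : ℝ → ℤ)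
      (a b b' : ℝ → Sym2 HexVertex) (Φ : ConformalEquiv D.carrier upperHalfPlaneSet)
      (L : ℂ → ℂ) (Lb Lb' : ℂ),
      D'.carrier = D.carrier → D'.pt 0 = D.pt 0 → 0 < ρ →
      D.carrier ∩ ball (D.pt 0) ρ = {z : ℂ | (D.pt 0).im < z.im} ∩ ball (D.pt 0) ρ →
      D.carrier ∩ ball (D.pt 1) ρ = {z : ℂ | (D.pt 1).im < z.im} ∩ ball (D.pt 1) ρ →
      D.carrier ∩ ball (D'.pt 1) ρ = {z : ℂ | (D'.pt 1).im < z.im} ∩ ball (D'.pt 1) ρ →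
      (∀ᶠ δ : ℝ in 𝓝[>] 0,
        hexDomainSimplyConnected (Λ δ) ∧ a δ ∈ hexDomainBoundary (Λ δ) ∧
        b δ ∈ hexDomainBoundary (Λ δ) ∧ b' δ ∈ hexDomainBoundary (Λ δ) ∧
        Nonempty (HexMidEdgeSAW (Λ δ) (a δ) (b δ)) ∧ Nonempty (HexMidEdgeSAW (Λ δ) (a δ) (b' δ)) ∧
        (hexGraph.induce (↑(Λ δ) : Set HexVertex)).Preconnected ∧
        (∀ v ∈ Λ δ, (δ : ℂ) * hexCenter v ∈ D.carrier) ∧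
        (∀ v : HexVertex, (δ : ℂ) * hexCenter v ∈ ball (D.pt 0) ρ → (v ∈ Λ δ ↔ m₀ δ ≤ v.1 1)) ∧
        (∀ v : HexVertex, (δ : ℂ) * hexCenter v ∈ ball (D.pt 1) ρ → (v ∈ Λ δ ↔ m δ ≤ v.1 1)) ∧
        (∀ v : HexVertex, (δ : ℂ) * hexCenter v ∈ ball (D'.pt 1) ρ → (v ∈ Λ δ ↔ m' δ ≤ v.1 1))) →
      (∀ K : Set ℂ, IsCompact K → K ⊆ D.carrier →
        ∀ᶠ δ : ℝ in 𝓝[>] 0, ∀ v : HexVertex, (δ : ℂ) * hexCenter v ∈ K → v ∈ Λ δ) →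
      Tendsto (fun δ : ℝ => (δ : ℂ) * hexMidpoint (a δ)) (𝓝[>] 0) (𝓝 (D.pt 0)) →
      Tendsto (fun δ : ℝ => (δ : ℂ) * hexMidpoint (b δ)) (𝓝[>] 0) (𝓝 (D.pt 1)) →
      Tendsto (fun δ : ℝ => (δ : ℂ) * hexMidpoint (b' δ)) (𝓝[>] 0) (𝓝 (D'.pt 1)) →
      Tendsto (fun x => ‖Φ x‖) (𝓝[D.carrier] (D.pt 0)) atTop →
      Φ.HasBoundaryValue (D.pt 1) 0 →
      ContinuousOn L D.carrier → (∀ z ∈ D.carrier, Complex.exp (L z) = deriv Φ z) →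
      Tendsto L (𝓝[D.carrier] (D.pt 1)) (𝓝 Lb) → Tendsto L (𝓝[D.carrier] (D'.pt 1)) (𝓝 Lb') →
      Tendsto (fun δ : ℝ =>
        ‖hexParafermionicObservable (Λ δ) (a δ) hexCriticalFugacity (5 / 8) (b' δ) /
          hexParafermionicObservable (Λ δ) (a δ) hexCriticalFugacity (5 / 8) (b δ)‖) (𝓝[>] 0)
        (𝓝 (Real.exp ((5 / 8) * (Lb' - Lb).re)))))
    (D D' : DobrushinDomain) (ρ : ℝ) (Λ Λ' : ℝ → Finset HexVertex) (m : ℝ → ℤ)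
    (a b : ℝ → Sym2 HexVertex) (hρ : 0 < ρ) (hD' : D.IsHullSubdomain D')
    (hev : (∀ᶠ δ : ℝ in 𝓝[>] 0,
      Λ' δ ⊆ Λ δ ∧ hexDomainSimplyConnected (Λ δ) ∧ hexDomainSimplyConnected (Λ' δ) ∧
      (hexGraph.induce (↑(Λ δ) : Set HexVertex)).Preconnected ∧
      (hexGraph.induce (↑(Λ' δ) : Set HexVertex)).Preconnected ∧
      a δ ∈ hexDomainBoundary (Λ δ) ∧ b δ ∈ hexDomainBoundary (Λ δ) ∧
      a δ ∈ hexDomainBoundary (Λ' δ) ∧ b δ ∈ hexDomainBoundary (Λ' δ) ∧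
      Nonempty (HexMidEdgeSAW (Λ' δ) (a δ) (b δ)) ∧
      (∀ v ∈ Λ δ, (δ : ℂ) * hexCenter v ∈ D.carrier ∧ m δ ≤ v.1 1) ∧
      (∀ v ∈ Λ' δ, (δ : ℂ) * hexCenter v ∈ D'.carrier) ∧
      (∀ v : HexVertex, (δ : ℂ) * hexCenter v ∈ ball (D.pt 0) ρ ∪ ball (D.pt 1) ρ →
        ((v ∈ Λ δ ↔ m δ ≤ v.1 1) ∧ (v ∈ Λ' δ ↔ m δ ≤ v.1 1)))))
    (hKΛ : ∀ K : Set ℂ, IsCompact K → K ⊆ D.carrier →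
      ∀ᶠ δ : ℝ in 𝓝[>] 0, ∀ v : HexVertex, (δ : ℂ) * hexCenter v ∈ K → v ∈ Λ δ)
    (hKΛ' : ∀ K : Set ℂ, IsCompact K → K ⊆ D'.carrier →
      ∀ᶠ δ : ℝ in 𝓝[>] 0, ∀ v : HexVertex, (δ : ℂ) * hexCenter v ∈ K → v ∈ Λ' δ)
    (ha : Tendsto (fun δ : ℝ => (δ : ℂ) * hexMidpoint (a δ)) (𝓝[>] 0) (𝓝 (D.pt 0)))
    (hb : Tendsto (fun δ : ℝ => (δ : ℂ) * hexMidpoint (b δ)) (𝓝[>] 0) (𝓝 (D.pt 1)))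
    {ρ₁ : ℝ} (hρ₁ : 0 < ρ₁) (hρ₁ρ : ρ₁ ≤ ρ)
    (hflat0 : D.carrier ∩ ball (D.pt 0) ρ = {z : ℂ | (D.pt 0).im < z.im} ∩ ball (D.pt 0) ρ)
    (hflat1 : D.carrier ∩ ball (D.pt 1) ρ = {z : ℂ | (D.pt 1).im < z.im} ∩ ball (D.pt 1) ρ)
    (hflat0' : D'.carrier ∩ ball (D.pt 0) ρ₁ = {z : ℂ | (D.pt 0).im < z.im} ∩ ball (D.pt 0) ρ₁)
    (hflat1' : D'.carrier ∩ ball (D.pt 1) ρ₁ = {z : ℂ | (D.pt 1).im < z.im} ∩ ball (D.pt 1) ρ₁)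
    (Ψ : ConformalEquiv D.carrier upperHalfPlaneSet) (L : ℂ → ℂ) (Lb : ℂ)
    (Ψ' : ConformalEquiv D'.carrier upperHalfPlaneSet) (L' : ℂ → ℂ) (L'b : ℂ)
    (hΨinf : Tendsto (fun z => ‖Ψ z‖) (𝓝[D.carrier] (D.pt 0)) atTop)
    (hΨb : Ψ.HasBoundaryValue (D.pt 1) 0)
    (hLc : ContinuousOn L D.carrier) (hLe : ∀ z ∈ D.carrier, Complex.exp (L z) = deriv Ψ z)
    (hLb : Tendsto L (𝓝[D.carrier] (D.pt 1)) (𝓝 Lb))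
    (hΨ'inf : Tendsto (fun z => ‖Ψ' z‖) (𝓝[D'.carrier] (D.pt 0)) atTop)
    (hΨ'b : Ψ'.HasBoundaryValue (D.pt 1) 0)
    (hL'c : ContinuousOn L' D'.carrier) (hL'e : ∀ z ∈ D'.carrier, Complex.exp (L' z) = deriv Ψ' z)
    (hL'b : Tendsto L' (𝓝[D'.carrier] (D.pt 1)) (𝓝 L'b))
    {t : ℝ} (ht0 : 0 < t) (htρ : t ≤ ρ₁ / 4)
    (hsfr : D.pt 0 + (t : ℂ) ∈ frontier D.carrier) (hsfr' : D.pt 0 + (t : ℂ) ∈ frontier D'.carrier)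
    {Ls L's : ℂ} (hLs : Tendsto L (𝓝[D.carrier] (D.pt 0 + t)) (𝓝 Ls))
    (hL's : Tendsto L' (𝓝[D'.carrier] (D.pt 0 + t)) (𝓝 L's))
    (e : ℝ → Sym2 HexVertex)
    (he : Tendsto (fun δ : ℝ => (δ : ℂ) * hexMidpoint (e δ)) (𝓝[>] 0) (𝓝 (D.pt 0 + t)))
    (heE : (∀ᶠ δ : ℝ in 𝓝[>] 0, e δ ∈ hexDomainBoundary (Λ δ) ∧ e δ ∈ hexDomainBoundary (Λ' δ) ∧
        Nonempty (HexMidEdgeSAW (Λ δ) (a δ) (e δ)) ∧ Nonempty (HexMidEdgeSAW (Λ' δ) (a δ) (e δ)) ∧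
        ∃ x yy : Site 2, a δ = s((x - Pi.single 1 1, 1), (x, 0)) ∧
          e δ = s((yy - Pi.single 1 1, 1), (yy, 0)) ∧ yy 1 = x 1 ∧ yy ≠ x)) :
    Tendsto (fun δ : ℝ =>
        ((∑ γ : HexMidEdgeSAW (Λ' δ) (a δ) (b δ), hexCriticalFugacity ^ γ.length) /
          (∑ γ : HexMidEdgeSAW (Λ' δ) (a δ) (e δ), hexCriticalFugacity ^ γ.length)) *
        ((∑ γ : HexMidEdgeSAW (Λ δ) (a δ) (e δ), hexCriticalFugacity ^ γ.length) /
          (∑ γ : HexMidEdgeSAW (Λ δ) (a δ) (b δ), hexCriticalFugacity ^ γ.length)))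
      (𝓝[>] 0) (𝓝 (Real.exp ((5 / 8) * ((Ls - Lb).re - (L's - L'b).re)))) := by
  have hρ₂ρ : ρ₁ / 2 ≤ ρ := by linarith
  have hf0 := flat_of_subset hflat0 (ball_subset_ball hρ₂ρ) rfl
  have hf1 := flat_of_subset hflat1 (ball_subset_ball hρ₂ρ) rfl
  have hf0' := flat_of_subset hflat0' (ball_subset_ball (by linarith : ρ₁ / 2 ≤ ρ₁)) rfl
  have hf1' := flat_of_subset hflat1' (ball_subset_ball (by linarith : ρ₁ / 2 ≤ ρ₁)) rfl
  -- floor forms of `a δ`, `b δ` (harvested from the floor data of an auxiliary floor point)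
  have hdaux : dist (D.pt 0 + ((ρ₁ / 16 : ℝ) : ℂ)) (D.pt 0) = ρ₁ / 16 := by
    rw [dist_eq_norm, add_sub_cancel_left, Complex.norm_real, Real.norm_eq_abs, abs_of_pos (by positivity)]
  obtain ⟨_, _, -, hevAB⟩ := floorData D D' ρ Λ Λ' m a b hρ hev ha hb (s := D.pt 0 + ((ρ₁ / 16 : ℝ) : ℂ))
    (pt_add_ne (by positivity)) (by simp) (by rw [hdaux]; linarith) one_pos (by rw [hdaux]; linarith)
  -- the floor point
  set s : ℂ := D.pt 0 + t with hs
  have hsa : s ≠ D.pt 0 := pt_add_ne ht0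
  have hsim : s.im = (D.pt 0).im := by simp [hs]
  have hdist_s : dist s (D.pt 0) = t := by
    rw [hs, dist_eq_norm, add_sub_cancel_left, Complex.norm_real, Real.norm_eq_abs, abs_of_pos ht0]
  obtain ⟨Ds, hDs_car, hDs0, hDs1⟩ := exists_remark D hsfr hsa
  obtain ⟨D's, hD's_car, hD's0, hD's1⟩ := exists_remark D' hsfr' (by rw [hD'.pt_zero_eq]; exact hsa)
  have hballs : ball s (ρ₁ / 2) ⊆ ball (D.pt 0) ρ₁ := by
    intro z hz
    rw [mem_ball] at hz ⊢
    calc dist z (D.pt 0) ≤ dist z s + dist s (D.pt 0) := dist_triangle _ _ _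
      _ < ρ₁ / 2 + t := by rw [hdist_s]; linarith
      _ ≤ ρ₁ := by linarith
  have hballsρ : ball s (ρ₁ / 2) ⊆ ball (D.pt 0) ρ := hballs.trans (ball_subset_ball hρ₁ρ)
  have hfs := flat_of_subset hflat0 hballsρ hsim
  have hfs' := flat_of_subset hflat0' hballs hsim
  -- target transport in `(D; a; b, s)` with `Λ`
  have T₁ : Tendsto (fun δ : ℝ =>
      ‖hexParafermionicObservable (Λ δ) (a δ) hexCriticalFugacity (5 / 8) (e δ) /
        hexParafermionicObservable (Λ δ) (a δ) hexCriticalFugacity (5 / 8) (b δ)‖) (𝓝[>] 0)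
      (𝓝 (Real.exp ((5 / 8) * (Ls - Lb).re))) := by
    refine hFRM D Ds (ρ₁ / 2) Λ m m m a b e Ψ L Lb Ls hDs_car hDs0
      (half_pos hρ₁) hf0 hf1 (by rw [hDs1]; exact hfs) ?_ hKΛ ha hb (by rw [hDs1]; exact he)
      hΨinf hΨb hLc hLe hLb (by rw [hDs1]; exact hLs)
    filter_upwards [hev, heE, hevAB] with δ hevδ hF hAB
    obtain ⟨-, hscΛ, -, hconn, -, haΛ, hbΛ, -, -, -, hΛD, -, hrows⟩ := hevδ
    obtain ⟨heΛ, -, hne_ae, -, -⟩ := hF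
    obtain ⟨_, _, _, -, -, -, -, -, -, -, -, -, -, -, -, -, hne_ab, -⟩ := hAB
    refine ⟨hscΛ, haΛ, hbΛ, heΛ, hne_ab, hne_ae, hconn, fun v hv => (hΛD v hv).1, ?_, ?_, ?_⟩
    · exact fun v hv => (hrows v (Or.inl (ball_subset_ball hρ₂ρ hv))).1
    · exact fun v hv => (hrows v (Or.inr (ball_subset_ball hρ₂ρ hv))).1
    · intro v hv
      rw [hDs1] at hv
      exact (hrows v (Or.inl (hballsρ hv))).1
  -- target transport in `(D'; a; b, s)` with `Λ'`
  have T₂ : Tendsto (fun δ : ℝ =>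
      ‖hexParafermionicObservable (Λ' δ) (a δ) hexCriticalFugacity (5 / 8) (e δ) /
        hexParafermionicObservable (Λ' δ) (a δ) hexCriticalFugacity (5 / 8) (b δ)‖) (𝓝[>] 0)
      (𝓝 (Real.exp ((5 / 8) * (L's - L'b).re))) := by
    refine hFRM D' D's (ρ₁ / 2) Λ' m m m a b e Ψ' L' L'b L's hD's_car hD's0
      (half_pos hρ₁) (by rw [hD'.pt_zero_eq]; exact hf0') (by rw [hD'.pt_one_eq]; exact hf1')
      (by rw [hD's1]; exact hfs') ?_ hKΛ' (by rw [hD'.pt_zero_eq]; exact ha)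
      (by rw [hD'.pt_one_eq]; exact hb) (by rw [hD's1]; exact he)
      (by rw [hD'.pt_zero_eq]; exact hΨ'inf) (by rw [hD'.pt_one_eq]; exact hΨ'b) hL'c hL'e
      (by rw [hD'.pt_one_eq]; exact hL'b) (by rw [hD's1]; exact hL's)
    filter_upwards [hev, heE] with δ hevδ hF
    obtain ⟨-, -, hscΛ', -, hconn', -, -, haΛ', hbΛ', hne', -, hΛ'D', hrows⟩ := hevδ
    obtain ⟨-, heΛ', -, hne_ae', -⟩ := hF
    refine ⟨hscΛ', haΛ', hbΛ', heΛ', hne', hne_ae', hconn', hΛ'D', ?_, ?_, ?_⟩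
    · intro v hv
      rw [hD'.pt_zero_eq] at hv
      exact (hrows v (Or.inl (ball_subset_ball hρ₂ρ hv))).2
    · intro v hv
      rw [hD'.pt_one_eq] at hv
      exact (hrows v (Or.inr (ball_subset_ball hρ₂ρ hv))).2
    · intro v hv
      rw [hD's1] at hv
      exact (hrows v (Or.inl (hballsρ hv))).2
  -- the quotient of the moduli
  have hA₂ : Real.exp ((5 / 8) * (L's - L'b).re) ≠ 0 := (Real.exp_pos _).ne'
  have hlim := T₁.div T₂ hA₂
  have hval : Real.exp ((5 / 8) * (Ls - Lb).re) / Real.exp ((5 / 8) * (L's - L'b).re) =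
      Real.exp ((5 / 8) * ((Ls - Lb).re - (L's - L'b).re)) := by
    rw [← Real.exp_sub]
    congr 1
    ring
  rw [hval] at hlim
  refine hlim.congr' ?_
  filter_upwards [hev, heE, hevAB] with δ hevδ hF hAB
  obtain ⟨-, -, hne_ae, hne_ae', x, yy, hax, hex, hyy1, hyyx⟩ := hF
  obtain ⟨x₂, x', _, hx₂1, hx'1, -, hx'x, -, hax₂, hbx, -, -, hrowsΛ, hrowsΛ', -, -, -, -⟩ := hAB
  have hxx : x₂ = x := floorEdge_inj (hax₂.symm.trans hax)
  subst hxx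
  have h1 := norm_hexParafermionicObservable_floorEdge (Λ δ) x₂ yy hrowsΛ hyy1 hyyx
  have h2 := norm_hexParafermionicObservable_floorEdge (Λ δ) x₂ x' hrowsΛ (hx'1.trans hx₂1.symm) hx'x
  have h3 := norm_hexParafermionicObservable_floorEdge (Λ' δ) x₂ yy hrowsΛ' hyy1 hyyx
  have h4 := norm_hexParafermionicObservable_floorEdge (Λ' δ) x₂ x' hrowsΛ' (hx'1.trans hx₂1.symm) hx'x
  have hpos1 := sum_pow_length_pos hne_ae
  have hpos2 := sum_pow_length_pos hne_ae'
  rw [hax, hex] at hpos1 hpos2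
  have key : ‖hexParafermionicObservable (Λ δ) (a δ) hexCriticalFugacity (5 / 8) (e δ) /
        hexParafermionicObservable (Λ δ) (a δ) hexCriticalFugacity (5 / 8) (b δ)‖ /
      ‖hexParafermionicObservable (Λ' δ) (a δ) hexCriticalFugacity (5 / 8) (e δ) /
        hexParafermionicObservable (Λ' δ) (a δ) hexCriticalFugacity (5 / 8) (b δ)‖ =
      ((∑ γ : HexMidEdgeSAW (Λ' δ) (a δ) (b δ), hexCriticalFugacity ^ γ.length) /
        (∑ γ : HexMidEdgeSAW (Λ' δ) (a δ) (e δ), hexCriticalFugacity ^ γ.length)) *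
      ((∑ γ : HexMidEdgeSAW (Λ δ) (a δ) (e δ), hexCriticalFugacity ^ γ.length) /
        (∑ γ : HexMidEdgeSAW (Λ δ) (a δ) (b δ), hexCriticalFugacity ^ γ.length)) := by
    rw [norm_div, norm_div, hax, hbx, hex, h1, h2, h3, h4]
    field_simp
  rw [Pi.div_apply]
  exact key

end Summit.CriticalPhenomena.SAWScalingLimit.Theorems.HexConjecture.RootLocality

end
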